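import Literature.NumberTheory.Automorphic.LieGraphCommutant
import HarnessLib

/-!
# The Lie-algebra isomorphism theorem, V: the graph subalgebra meets `0 × 𝔤₂` and `𝔤₁ × 0` trivially
(trunk T-AUTOMORPHIC, G25 AutomorphicL; Humphreys 14.2 adapted to reductive `𝔤`; DAG of `chevalley_isomorphism`)

Continuation of `LieGraphSetup/Core/Swap/Commutant.lean`. For the graph subalgebra
`D = graphSubalgebra hT₁ hT₂ h₁ h₂ y ≤ 𝔤₁ × 𝔤₂` (`y` a regular coweight):

* **`snd_eq_zero_of_inr_mem`** — `(0, B) ∈ D ⇒ B = 0`;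
* **`fst_eq_zero_of_inl_mem`** — `(A, 0) ∈ D ⇒ A = 0` (by the swap symmetry, `LieGraphSwap.lean`).

Proof of the first: `J = {B | (0, B) ∈ D}` is a subspace of `𝔤₂` stable under `Ad(T₂)` (through
`σ_t`, `conj_mem_inrSub`), hence spanned by weight vectors (`iSup_inf_adWeightSpace_eq`); a non-zero
weight vector `B ∈ J` of weight `x ∈ X` (`exists_weightVector_of_adStable`) is impossible: for `x` a
root `α_γ` it is a multiple of `e²_γ` and `(0, e²_γ) ∉ D` (`not_inr_rootE_mem`); for `x ≠ 0` not a
root `𝔤₂_x = 0`; for `x = 0`, `B ∈ Lie(T₂)` and `[B, e²_γ] = dα_γ(B) e²_γ`, so either some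
`(0, e²_γ) ∈ D` again, or `B` commutes with every root vector, hence with `G₂`
(`forall_mul_eq_mul_of_central`), and then the trace functionals of part IV give
`tr (B^{m+1}) = 0` for all `m` (`trace_mul_eq_zero_of_inr_mem` with `φ = B^m`), forcing `B = 0` for
the semisimple `B` (`eq_zero_of_mem_lieAlgebraGL_torus_of_trace_pow`).

## References

* [Humphreys1972] J. E. Humphreys, *Introduction to Lie Algebras and Representation Theory*,
  GTM 9, Springer (1972), §14.2.
* [SpringerLAG1998] T. A. Springer, *Linear Algebraic Groups*, 2nd ed. (1998), 7.1.1, 8.1.1–8.1.3.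
-/

noncomputable section

open scoped MatrixGroups IsMulCommutative
open Set

attribute [local instance 100] LieRing.ofAssociativeRing

namespace Literature.NumberTheory.Automorphic

/-! ### Weight vectors in `Ad(T)`-stable subspaces -/

section AdStable

variable {k : Type*} [Field k] [IsAlgClosed k] {n : Type*} [Fintype n] [DecidableEq n]
variable {X : Type*} [AddCommGroup X] {T : Subgroup (GL n k)}

/-- **A non-zero `Ad(T)`-stable subspace of `𝔤𝔩_n` contains a non-zero weight vector of some weight
`x ∈ X ≅ X*(T)`** (`T` a torus): it is the sum of its intersections with the weight spaces of the
commuting semisimple family `Ad(T)`, and the weight of a non-zero weight vector is an algebraic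
character. [cite: SpringerLAG1998, 3.2.3 and 7.1.1] -/
theorem exists_weightVector_of_adStable (hT : IsTorusSubgroup T)
    (eX : Additive ↥(characterLattice T) ≃+ X) {J : Submodule k (Matrix n n k)}
    (hJ : ∀ t : ↥T, ∀ B ∈ J, adGL (t : GL n k) B ∈ J) (hJ0 : J ≠ ⊥) :
    ∃ x : X, ∃ B ∈ J, B ≠ 0 ∧ B ∈ weightSpaceGL T (charOfWeight eX x) := by
  haveI : IsMulCommutative ↥T := hT.2.1
  have hdec := iSup_inf_adWeightSpace_eq (T := T) (fun t ht => hT.2.2 t ht) J hJ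
  -- some piece `J ⊓ adWeightSpace T w` is non-zero
  obtain ⟨w, hw⟩ : ∃ w : ↥T → k, J ⊓ adWeightSpace T w ≠ ⊥ := by
    by_contra hall
    push Not at hall
    apply hJ0
    rw [← hdec]
    simp [hall]
  obtain ⟨B, hB, hB0⟩ := (Submodule.ne_bot_iff _).1 hw
  rw [Submodule.mem_inf] at hB
  -- its weight is the algebraic character `adWeightChar`
  set χ : ↥(characterLattice T) := ⟨adWeightChar hB.2 hB0, isAlgebraicChar_adWeightChar hB.2 hB0⟩ with hχ
  refine ⟨eX (Additive.ofMul χ), B, hB.1, hB0, ?_⟩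
  have hc : charOfWeight eX (eX (Additive.ofMul χ)) = (χ : ↥T →* kˣ) := by simp [charOfWeight]
  rw [hc, weightSpaceGL_eq_adWeightSpace]
  have hw' : (fun t => (((χ : ↥T →* kˣ) t : kˣ) : k)) = w := funext fun t => adWeightChar_apply hB.2 hB0 t
  rw [hw']
  exact hB.2

end AdStable

namespace LieGraph

variable {k : Type*} [Field k]
variable {n₁ n₂ : Type*} [Fintype n₁] [DecidableEq n₁] [Fintype n₂] [DecidableEq n₂]
variable {ι X Y : Type*} [AddCommGroup X] [AddCommGroup Y]
variable {G₁ T₁ : Subgroup (GL n₁ k)} {G₂ T₂ : Subgroup (GL n₂ k)}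
  [IsMulCommutative ↥T₁] [IsMulCommutative ↥T₂]
variable {P : RootPairing ι ℤ X Y}
variable {eX₁ : Additive ↥(characterLattice T₁) ≃+ X} {eY₁ : Additive ↥(cocharacterLattice T₁) ≃+ Y}
variable {eX₂ : Additive ↥(characterLattice T₂) ≃+ X} {eY₂ : Additive ↥(cocharacterLattice T₂) ≃+ Y}

section Center

variable [IsAlgClosed k] [CharZero k] [Fintype ι]
variable (hG₁ : IsConnectedReductive G₁) (hT₁ : IsMaximalTorusIn T₁ G₁)
  (hG₂ : IsConnectedReductive G₂) (hT₂ : IsMaximalTorusIn T₂ G₂)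
  (h₁ : IsRootDatumOf G₁ T₁ P eX₁ eY₁) (h₂ : IsRootDatumOf G₂ T₂ P eX₂ eY₂)

/-- The subspace `J = {B | (0, B) ∈ D}` of `𝔤𝔩_{n₂}`. [cite: Humphreys1972, 14.2] -/
def inrSub (y : Y) : Submodule k (Matrix n₂ n₂ k) :=
  (graphSubalgebra hT₁ hT₂ h₁ h₂ y).toSubmodule.comap (LinearMap.inr k (Matrix n₁ n₁ k) (Matrix n₂ n₂ k))

omit [CharZero k] [Fintype ι] in
/-- Membership in `inrSub`. [folklore] -/
lemma mem_inrSub_iff {y : Y} {B : Matrix n₂ n₂ k} :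
    B ∈ inrSub hT₁ hT₂ h₁ h₂ y ↔
      (((0 : Matrix n₁ n₁ k), B) : Matrix n₁ n₁ k × Matrix n₂ n₂ k) ∈ graphSubalgebra hT₁ hT₂ h₁ h₂ y :=
  Iff.rfl

omit [CharZero k] [Fintype ι] in
/-- **`J` is `Ad(T₂)`-stable** (apply `σ_{f⁻¹ t}` to `(0, B)`). [cite: Humphreys1972, 14.2] -/
theorem conj_mem_inrSub (y : Y) (t : ↥T₂) {B : Matrix n₂ n₂ k} (hB : B ∈ inrSub hT₁ hT₂ h₁ h₂ y) :
    adGL (t : GL n₂ k) B ∈ inrSub hT₁ hT₂ h₁ h₂ y := by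
  rw [mem_inrSub_iff] at hB ⊢
  have h := sigma_mem_graphSubalgebra y ((torusIso eX₁ eX₂ hT₁.2.1 hT₂.2.1).symm t) hB
  rw [sigma_apply, MulEquiv.apply_symm_apply] at h
  simpa only [Matrix.mul_zero, Matrix.zero_mul, adGL_apply] using h

include hG₁ hG₂ in
/-- **`(0, B) ∈ D ⇒ B = 0`.** [cite: Humphreys1972, 14.2] -/
theorem snd_eq_zero_of_inr_mem {y : Y} (hy : ∀ i, P.root' i y ≠ 0) {B : Matrix n₂ n₂ k}
    (hB : (((0 : Matrix n₁ n₁ k), B) : Matrix n₁ n₁ k × Matrix n₂ n₂ k) ∈ graphSubalgebra hT₁ hT₂ h₁ h₂ y) :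
    B = 0 := by
  haveI : Infinite k := IsAlgClosed.instInfinite
  by_contra hB0
  have hJ0 : inrSub hT₁ hT₂ h₁ h₂ y ≠ ⊥ := fun hbot => by
    have : B ∈ inrSub hT₁ hT₂ h₁ h₂ y := hB
    rw [hbot, Submodule.mem_bot] at this
    exact hB0 this
  obtain ⟨x, B', hB'J, hB'0, hB'w⟩ := exists_weightVector_of_adStable hT₂.2.1 eX₂
    (fun t B hB => conj_mem_inrSub hT₁ hT₂ h₁ h₂ y t hB) hJ0
  rw [mem_inrSub_iff] at hB'J
  have hB'g : B' ∈ lieWeightSpace G₂ T₂ (charOfWeight eX₂ x) := ⟨(mem_lieAlgebraGL_of_mem hB'J).2, hB'w⟩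
  -- scaling `(0, c⁻¹ • B')`-type consequences: `(0, e²_γ) ∈ D` is excluded
  have key : ∀ (γ : ι) (c : k), c ≠ 0 →
      (((0 : Matrix n₁ n₁ k), c • h₂.rootE γ) : Matrix n₁ n₁ k × Matrix n₂ n₂ k) ∈ graphSubalgebra hT₁ hT₂ h₁ h₂ y →
        False := by
    intro γ c hc hmem
    have := (graphSubalgebra hT₁ hT₂ h₁ h₂ y).smul_mem c⁻¹ hmem
    rw [Prod.smul_mk, smul_zero, smul_smul, inv_mul_cancel₀ hc, one_smul] at this
    exact not_inr_rootE_mem hG₁ hT₁ hG₂ hT₂ h₁ h₂ hy γ this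
  by_cases hx0 : x = 0
  · -- `B' ∈ Lie(T₂)`
    subst hx0
    rw [lieWeightSpace_charOfWeight_zero_eq, lieWeightSpace_one_eq hG₂ hT₂] at hB'g
    -- `B'` commutes with every `e²_γ`
    have hcomm : ∀ γ : ι, B' * h₂.rootE γ = h₂.rootE γ * B' := by
      intro γ
      have e := lie_eq_dChar_smul (Additive.toMul (eX₂.symm (P.root γ))) (h₂.rootE_mem γ).2 hB'g
      by_cases hc : dChar (Additive.toMul (eX₂.symm (P.root γ))) B' = 0
      · rw [hc, zero_smul, sub_eq_zero] at e; exact e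
      · exfalso
        obtain ⟨d, hd, hd2⟩ := exists_mem_snd_eq_rootE (hG₂ := hG₂) (hT₁ := hT₁) (hT₂ := hT₂) (h₁ := h₁)
          (h₂ := h₂) hy γ
        have hl := (graphSubalgebra hT₁ hT₂ h₁ h₂ y).lie_mem hB'J hd
        rw [inr_lie, hd2, e] at hl
        exact key γ _ hc hl
    -- hence with `G₂`, and all `tr (B'^{m+1}) = 0`
    have hG := forall_mul_eq_mul_of_central hG₂ hT₂ h₂ hB'g hcomm
    have hpow : ∀ m : ℕ, ∀ g ∈ G₂, ((g : GL n₂ k) : Matrix n₂ n₂ k) * B' ^ m = B' ^ m * g := by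
      intro m g hg
      induction m with
      | zero => simp
      | succ m ih => rw [pow_succ, ← Matrix.mul_assoc, ih, Matrix.mul_assoc, hG g hg, Matrix.mul_assoc]
    have htr : ∀ m : ℕ, 1 ≤ m → Matrix.trace (B' ^ m) = 0 := by
      intro m hm
      obtain ⟨m, rfl⟩ := Nat.exists_eq_add_of_le' hm
      rw [pow_succ']
      exact trace_mul_eq_zero_of_inr_mem (hG₁ := hG₁) (hT₁ := hT₁) (hT₂ := hT₂) (h₁ := h₁) (h₂ := h₂)
        hB'J (hpow m)
    exact hB'0 (eq_zero_of_mem_lieAlgebraGL_torus_of_trace_pow hT₂.2.1 hB'g htr)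
  · by_cases hx : x ∈ range P.root
    · obtain ⟨γ, rfl⟩ := hx
      obtain ⟨c, hc⟩ := (h₂.mem_lieWeightSpace_root_iff hG₂ hT₂ γ).1 hB'g
      have hc0 : c ≠ 0 := by rintro rfl; rw [zero_smul] at hc; exact hB'0 hc
      rw [hc] at hB'J
      exact key γ c hc0 hB'J
    · rw [h₂.lieWeightSpace_charOfWeight_eq_bot hG₂ hT₂ hx0 hx, Submodule.mem_bot] at hB'g
      exact hB'0 hB'g

include hG₁ hG₂ in
/-- **`(A, 0) ∈ D ⇒ A = 0`** (swap symmetry). [cite: Humphreys1972, 14.2] -/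
theorem fst_eq_zero_of_inl_mem {y : Y} (hy : ∀ i, P.root' i y ≠ 0) {A : Matrix n₁ n₁ k}
    (hA : ((A, (0 : Matrix n₂ n₂ k)) : Matrix n₁ n₁ k × Matrix n₂ n₂ k) ∈ graphSubalgebra hT₁ hT₂ h₁ h₂ y) :
    A = 0 :=
  snd_eq_zero_of_inr_mem hG₂ hT₂ hG₁ hT₁ h₂ h₁ hy (swap_mem_graphSubalgebra hT₁ hT₂ h₁ h₂ y hA)

include hG₁ hG₂ in
/-- **`D` is the graph of a bijection between its projections**: two elements of `D` with the same
first component are equal, and likewise for the second component. [cite: Humphreys1972, 14.2] -/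
theorem eq_of_fst_eq {y : Y} (hy : ∀ i, P.root' i y ≠ 0) {A B : Matrix n₁ n₁ k × Matrix n₂ n₂ k}
    (hA : A ∈ graphSubalgebra hT₁ hT₂ h₁ h₂ y) (hB : B ∈ graphSubalgebra hT₁ hT₂ h₁ h₂ y) (h : A.1 = B.1) :
    A = B := by
  have hsub := (graphSubalgebra hT₁ hT₂ h₁ h₂ y).sub_mem hA hB
  have h1 : (A - B).1 = 0 := by rw [Prod.fst_sub, h, sub_self]
  have h2 : (A - B).2 = 0 := by
    refine snd_eq_zero_of_inr_mem hG₁ hT₁ hG₂ hT₂ h₁ h₂ hy (B := (A - B).2) ?_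
    have : A - B = ((0 : Matrix n₁ n₁ k), (A - B).2) := Prod.ext h1 rfl
    rwa [this] at hsub
  have : A - B = 0 := Prod.ext h1 h2
  exact sub_eq_zero.1 this

include hG₁ hG₂ in
/-- Second-component version of `eq_of_fst_eq`. [cite: Humphreys1972, 14.2] -/
theorem eq_of_snd_eq {y : Y} (hy : ∀ i, P.root' i y ≠ 0) {A B : Matrix n₁ n₁ k × Matrix n₂ n₂ k}
    (hA : A ∈ graphSubalgebra hT₁ hT₂ h₁ h₂ y) (hB : B ∈ graphSubalgebra hT₁ hT₂ h₁ h₂ y) (h : A.2 = B.2) :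
    A = B := by
  have hsub := (graphSubalgebra hT₁ hT₂ h₁ h₂ y).sub_mem hA hB
  have h2 : (A - B).2 = 0 := by rw [Prod.snd_sub, h, sub_self]
  have h1 : (A - B).1 = 0 := by
    refine fst_eq_zero_of_inl_mem hG₁ hT₁ hG₂ hT₂ h₁ h₂ hy (A := (A - B).1) ?_
    have : A - B = ((A - B).1, (0 : Matrix n₂ n₂ k)) := Prod.ext rfl h2
    rwa [this] at hsub
  have : A - B = 0 := Prod.ext h1 h2
  exact sub_eq_zero.1 this

end Center

end LieGraph

end Literature.NumberTheory.Automorphic
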